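/-
Copyright (c) 2026 the pub-hodgecm-mathlib formalisation cell (harness21).  Prover seat hodgecm-mathlib-F0P2-p01 (g13), 2026-09-01.  Road «S3-tree», hand «T4′-GEN, GROUP SIDE»
(architect A-p16 (g29) A-85 (5)): on `U(H)(L⁺_v) ⧸ U(H)(𝒪_v)` the INTERIOR level-1 fixed cosets of `γ` are the fixed cosets of the Cayley shift `u`, and a level-2 class
datum of `γ` on them is a level-1 class datum of `u` relabelled by `r = 1 + ϖ·(q − 1)`.
-/
import Literature.NumberTheory.Automorphic.UnitaryLevelOrbitalIntegralLatticeCount   -- ★ (F2) p845770 (F0P3a-p03): `cmLocalIntegralLevel` ∕ `localNonsplitEquiv` ∕ `glInt` plumbing, ★ `mem_fixedBy_quotient_mk_iff`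
import Literature.NumberTheory.Automorphic.UnitaryLatticeTreeLevelShiftClass         -- ★ T4′-GEN p845888 (this seat): relabelling algebra; ⊇ ★ ORDER-STABILITY p845548, ★ C1 p845386, ★ `…Stabilizer`
import Literature.NumberTheory.GaloisRepresentations.CompletionCompositumUnitBall      -- ★ `SemiLocal.valuation_le_one_iff_valued_le_one` (the `Valued` ↔ `valuation` bridge on `L_w`)
import HarnessLib

/-!
# The interior level-one fixed cosets of `γ` are the fixed cosets of its Cayley shift; level-two class data relabel (road «S3-tree», T4′-GEN group side; Kottwitz 1986 §3,
# Rogawski 1990 §4.9)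

Topic `NumberTheory/Automorphic`; namespace `Literature.NumberTheory.Automorphic`.  THEOREMS ONLY (no definition, no instance, no notation, no named fact, no `sorry`).
Cell `pub/hodgecm-mathlib` (D-0151), crux H413 = `stmt-HodgeConjecture-24833`; road «S3-tree» (LEAD F0P3a-plan (g11); architect A-p16 (g29) A-68 (b), A-69, A-83, A-85 (5);
END F0P3a-p03 (g15) «PARTIAL HEAD» `localTransferAtOne_of_hyperspecialLevel_le_two`; P-1 F0P3b-p01 (g12)).  Seat F0P2-p01 (g13).  HONEST LABEL: HC_CM is proved only modulo
the 2 remaining named inputs (hLiu418 24832, h413 24833) until rung 0 closes; nothing printed is asserted here — this is the lattice∕coset dictionary and matrix algebra.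

THE SETTING.  `G = (cmDatum L N H).Local v = U(H)(L⁺_v)` at a NON-SPLIT place `v` (`w` the place above, `hw : c • w = w`), `K = cmLocalIntegralLevel L N H v = U(H)(𝒪_v)`,
`e = localNonsplitEquiv … w hw : G ≃ U(σ_w, H_w)(L_w)` the one-place model, `ϖ ∈ L_w` with `0 < |ϖ| < 1`.  For `γ ∈ G` write `X := γ_w^{(ϖ)} = 1 + ϖ⁻¹(e γ − 1)` and let
`u ∈ G` be an element whose matrix `e u` generates the same order as `X` (`e u, (e u)⁻¹ ∈ 𝒪[X]`, `X ∈ 𝒪[e u]` — the CAYLEY element of ★ `SplitTorusOrderCayleyShift`, T3′).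
TOKENS (architect A-69 (β), A-85 (5)): congruences are spelled with ★ T1a `IsIntMatrix` and `Valued.v` on `L_w`: «`x_w ≡ 1 (mod ϖ^j)`» is
`IsIntMatrix ((ϖ ^ j)⁻¹ • (↑(e x) − 1))`; the `valuation`-spelling of ★ (F2) ∕ HEAD v4 is bridged in §1.

THE MATHEMATICS.
* §1 bridges (`isIntMatrix_inv_smul_iff`, `mem_adjoin_singleton_of_forall_mem_iff`, `mem_integer_valuation_iff_mem_integer_valued`, `mem_glInt_iff_isIntMatrix`,
  `mem_cmLocalIntegralLevel_iff_isIntMatrix`, `coe_localNonsplitEquiv_conj`, `coe_localNonsplitEquiv_mul_inv`): `glInt` ∕ `K` membership ↔ `IsIntMatrix` of the matrix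
  and its inverse on `L_w`; `IsIntMatrix (c⁻¹ • A) ↔ ∀ i k, |A i k| ≤ |c|`; `adjoin`-membership is insensitive to which of the two (equal) integer subrings of `L_w` is the
  coefficient ring; `e` on conjugates.
* §2 `sep_fixedBy_quotient_eq_fixedBy` (abstract), **`sep_fixedBy_interior_eq_fixedBy_of_mem_adjoin`**: `{q ∈ Fix_γ(G⧸K) : (q.out⁻¹γq.out)_w ≡ 1 (mod ϖ)} = Fix_u(G⧸K)`
  — ★ C1 (`mapGL_eq_and_level_iff_map_levelShift_le`) + ★ ORDER-STABILITY (`mapGL_eq_iff_map_toLin'_le`) read on the lattice `latt (e q.out)`, with `K ↔ GL_N(𝒪_w)` by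
  ★ `mem_localIntegralLevel_iff_of_smul_eq`; hence **`sum_fixedBy_interior_eq_sum_fixedBy_cayley_relabel`**: `∑ᶠ_{q ∈ Fix_γ, interior} F q = ∑ᶠ_{q ∈ Fix_u} F q` for
  every summand `F` (A-69 (iii), A-85 (5)).
* §3 **`coe_localNonsplitEquiv_conj_eq_aeval_relabel`**: with `q(e u) = X` (`q ∈ 𝒪_w[T]`) and `r := 1 + ϖ·(q − 1)`, `e(g⁻¹γg) = r(e(g⁻¹ug))` for every `g ∈ G`
  (★ `units_conj_eq_aeval_relabel`); **`apply_conj_eq_of_levelTwo_of_relabel`**: for `ψ` on `G` LEFT-INVARIANT UNDER LEVEL 2 (`hψ2 : ∀ U, IsIntMatrix ((ϖ^2)⁻¹ • (↑(e U) − 1))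
  → ∀ x, ψ (U * x) = ψ x`, A-69 (β) at `j = 2`): if `g⁻¹ug ∈ K`, `k ∈ K` represents the level-1 class of `g⁻¹ug` (`(g⁻¹ug)_w ≡ k_w (mod ϖ)`) and `k₂ ∈ K` the relabelled
  class (`r(k_w) ≡ (k₂)_w (mod ϖ²)`), then `ψ(g⁻¹γg) = ψ(k₂)` — THE LEVEL GAIN (★ `isIntMatrix_inv_pow_succ_smul_aeval_relabel_sub`) read on the group: the value of a
  level-2 piece at an interior fixed coset of `γ` is determined by the level-1 class of `u` there (move `k` in its `K`-class with the piece's Ad(`K`)-invariance).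
This is the induction step `(γ, level 2) ↦ (u, level 1)` of the END's partial theorem (A-83: pieces of hyperspecial level ≤ 2): interior term of the unfolded orbital integral
of `γ` (★ `classOrbitalIntegral_eq_sum_fixedBy_of_support_subset_of_conj_invariant…`) = a level-1 class sum over `Fix_u`, which T3′ (P-1∕P-2∕P-3) evaluates.

## References
* [Kottwitz1986] R. E. Kottwitz, *Base change for unit elements of Hecke algebras*, Compositio Math. 60 (1986): §3.
* [Rogawski1990] J. Rogawski, Ann. of Math. Stud. 123 (1990): §4.9 Prop. 4.9.1 (a) p. 55.
* [Laumon1995] G. Laumon, *Cohomology of Drinfeld Modular Varieties* I (1996): Lemma (5.3.2) p. 136.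
* [PlatonovRapinchuk1994] V. Platonov, A. Rapinchuk, *Algebraic Groups and Number Theory* (1994): §5.1 (the one-place model).
-/

set_option autoImplicit false

noncomputable section

open scoped Valued WithZero Matrix MatrixGroups Polynomial
open Set NumberField IsDedekindDomain Polynomial

namespace Literature.NumberTheory.Automorphic

open UnitaryGroup Literature.NumberTheory.Automorphic.UnitaryLatticeTree Literature.NumberTheory.Automorphic.HermitianLattice

/-! ## §1 Bridges on `L_w`: `glInt` ↔ `IsIntMatrix`; `IsIntMatrix (c⁻¹ • A)`; the coefficient ring of `adjoin` -/

section Bridges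

variable {K : Type*} [Field K] [Valued K ℤᵐ⁰] {N : ℕ}

/-- `IsIntMatrix (c⁻¹ • A) ↔ ∀ i k, |A i k| ≤ |c|` (`c ≠ 0`). [cite: Kottwitz1986, §3] -/
theorem isIntMatrix_inv_smul_iff {c : K} (hc : c ≠ 0) (A : Matrix (Fin N) (Fin N) K) :
    IsIntMatrix (c⁻¹ • A) ↔ ∀ i k, Valued.v (A i k) ≤ Valued.v c := by
  have hc' : Valued.v c ≠ 0 := (Valuation.ne_zero_iff _).2 hc
  refine forall_congr' fun i => forall_congr' fun k => ?_
  rw [Matrix.smul_apply, smul_eq_mul, map_mul, map_inv₀, ← div_eq_inv_mul, div_le_one₀ (zero_lt_iff.2 hc')]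

omit [Valued K ℤᵐ⁰] in
/-- `adjoin`-membership does not depend on which of two subrings with the same elements is the coefficient ring (on `L_w`: the `Valued` and the `ValuativeRel` integers).
[cite: Kottwitz1986, §3] -/
theorem mem_adjoin_singleton_of_forall_mem_iff (R₁ R₂ : Subring K) (h : ∀ x : K, x ∈ R₁ ↔ x ∈ R₂) {x y : Matrix (Fin N) (Fin N) K}
    (hy : y ∈ Algebra.adjoin R₁ ({x} : Set (Matrix (Fin N) (Fin N) K))) : y ∈ Algebra.adjoin R₂ ({x} : Set (Matrix (Fin N) (Fin N) K)) := by
  induction hy using Algebra.adjoin_induction with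
  | mem z hz => exact Algebra.subset_adjoin hz
  | algebraMap r =>
      have e : algebraMap R₁ (Matrix (Fin N) (Fin N) K) r = algebraMap R₂ (Matrix (Fin N) (Fin N) K) ⟨(r : K), (h r).1 r.2⟩ := by
        rw [Algebra.algebraMap_eq_smul_one, Algebra.algebraMap_eq_smul_one]; rfl
      rw [e]
      exact Subalgebra.algebraMap_mem _ _
  | add z z' _ _ hz hz' => exact add_mem hz hz'
  | mul z z' _ _ hz hz' => exact mul_mem hz hz'

end Bridges

section Place

variable (L : Type) [Field L] [NumberField L] [IsCMField L] (N : ℕ) (H : Matrix (Fin N) (Fin N) L)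
  {v : HeightOneSpectrum (𝓞 ↥(maximalRealSubfield L))} (hc : IsCMField.complexConj L ≠ 1)
  (w : UnitaryGroup.PlacesOver L v) (hw : IsCMField.complexConj L • w.1 = w.1)

omit [IsCMField L] in
/-- On `L_w`: the `ValuativeRel` integers and the `Valued` integers coincide (★ `SemiLocal.valuation_le_one_iff_valued_le_one`). [cite: PlatonovRapinchuk1994, §5.1] -/
theorem mem_integer_valuation_iff_mem_integer_valued (x : w.1.adicCompletion L) :
    x ∈ (ValuativeRel.valuation (w.1.adicCompletion L)).integer ↔ x ∈ 𝒪[w.1.adicCompletion L] := by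
  rw [Valuation.mem_integer_iff, Valuation.mem_integer_iff]
  exact Literature.NumberTheory.GaloisRepresentations.SemiLocal.valuation_le_one_iff_valued_le_one x

omit [IsCMField L] in
/-- **`g ∈ GL_N(𝒪_w)` (★ `glInt`, `valuation` currency) ↔ `g` and `g⁻¹` are `IsIntMatrix` (★ T1a, `Valued` currency).** [cite: PlatonovRapinchuk1994, §5.1] -/
theorem mem_glInt_iff_isIntMatrix (g : GL (Fin N) (w.1.adicCompletion L)) :
    g ∈ glInt N (w.1.adicCompletion L) ↔
      IsIntMatrix (g : Matrix (Fin N) (Fin N) (w.1.adicCompletion L)) ∧ IsIntMatrix ((g⁻¹ : GL (Fin N) (w.1.adicCompletion L)) : Matrix (Fin N) (Fin N) (w.1.adicCompletion L)) := by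
  rw [mem_glInt_iff]
  refine and_congr (forall_congr' fun i => forall_congr' fun j => ?_) (forall_congr' fun i => forall_congr' fun j => ?_) <;>
    rw [mem_integer_valuation_iff_mem_integer_valued, Valuation.mem_integer_iff]

/-- **`x ∈ K = U(H)(𝒪_v)` ↔ `e x` and `(e x)⁻¹` are `IsIntMatrix`** (★ `mem_localIntegralLevel_iff_of_smul_eq` + §1). [cite: PlatonovRapinchuk1994, §5.1] -/
theorem mem_cmLocalIntegralLevel_iff_isIntMatrix (x : (cmDatum L N H).Local v) :
    x ∈ cmLocalIntegralLevel L N H v ↔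
      IsIntMatrix (((localNonsplitEquiv (IsCMField.complexConj L) H hc w hw x :
          ↥(unitaryGroupOfForm (galAdicCompletionMap (L := L) (IsCMField.complexConj L) hw) (placeForm H w.1))) :
            GL (Fin N) (w.1.adicCompletion L)) : Matrix (Fin N) (Fin N) (w.1.adicCompletion L)) ∧
      IsIntMatrix ((((localNonsplitEquiv (IsCMField.complexConj L) H hc w hw x :
          ↥(unitaryGroupOfForm (galAdicCompletionMap (L := L) (IsCMField.complexConj L) hw) (placeForm H w.1))) :
            GL (Fin N) (w.1.adicCompletion L))⁻¹ : GL (Fin N) (w.1.adicCompletion L)) : Matrix (Fin N) (Fin N) (w.1.adicCompletion L)) :=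
  (mem_localIntegralLevel_iff_of_smul_eq (IsCMField.complexConj L) N H hc w hw x).trans (mem_glInt_iff_isIntMatrix L N w _)

/-- `e (g⁻¹ x g) = (e g)⁻¹ (e x) (e g)` in `GL_N(L_w)`. [cite: PlatonovRapinchuk1994, §5.1] -/
theorem coe_localNonsplitEquiv_conj (g x : (cmDatum L N H).Local v) :
    ((localNonsplitEquiv (IsCMField.complexConj L) H hc w hw (g⁻¹ * x * g) :
        ↥(unitaryGroupOfForm (galAdicCompletionMap (L := L) (IsCMField.complexConj L) hw) (placeForm H w.1))) : GL (Fin N) (w.1.adicCompletion L)) =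
      ((localNonsplitEquiv (IsCMField.complexConj L) H hc w hw g :
          ↥(unitaryGroupOfForm (galAdicCompletionMap (L := L) (IsCMField.complexConj L) hw) (placeForm H w.1))) : GL (Fin N) (w.1.adicCompletion L))⁻¹ *
        ((localNonsplitEquiv (IsCMField.complexConj L) H hc w hw x :
          ↥(unitaryGroupOfForm (galAdicCompletionMap (L := L) (IsCMField.complexConj L) hw) (placeForm H w.1))) : GL (Fin N) (w.1.adicCompletion L)) *
        ((localNonsplitEquiv (IsCMField.complexConj L) H hc w hw g :
          ↥(unitaryGroupOfForm (galAdicCompletionMap (L := L) (IsCMField.complexConj L) hw) (placeForm H w.1))) : GL (Fin N) (w.1.adicCompletion L)) := by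
  have h1 : localNonsplitEquiv (IsCMField.complexConj L) H hc w hw (g⁻¹ * x * g) =
      localNonsplitEquiv (IsCMField.complexConj L) H hc w hw (g⁻¹ * x) * localNonsplitEquiv (IsCMField.complexConj L) H hc w hw g :=
    map_mul (localNonsplitEquiv (IsCMField.complexConj L) H hc w hw) _ _
  have h2 : localNonsplitEquiv (IsCMField.complexConj L) H hc w hw (g⁻¹ * x) =
      localNonsplitEquiv (IsCMField.complexConj L) H hc w hw g⁻¹ * localNonsplitEquiv (IsCMField.complexConj L) H hc w hw x :=
    map_mul (localNonsplitEquiv (IsCMField.complexConj L) H hc w hw) _ _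
  have h3 : localNonsplitEquiv (IsCMField.complexConj L) H hc w hw g⁻¹ = (localNonsplitEquiv (IsCMField.complexConj L) H hc w hw g)⁻¹ :=
    map_inv (localNonsplitEquiv (IsCMField.complexConj L) H hc w hw) _
  rw [h1, h2, h3, Subgroup.coe_mul, Subgroup.coe_mul, Subgroup.coe_inv]

/-- **Separated fixed cosets, abstractly**: if for every `g`, «`g⁻¹γg ∈ K` and `Y(g⁻¹γg)`» ↔ «`g⁻¹ug ∈ K`», then `{q ∈ Fix_γ(G⧸K) : Y(q.out⁻¹ γ q.out)} = Fix_u(G⧸K)`.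
[cite: Kottwitz1986, §3] -/
theorem sep_fixedBy_quotient_eq_fixedBy {G : Type*} [Group G] (K₀ : Subgroup G) (γ u : G) (Y : G → Prop)
    (h : ∀ g : G, (g⁻¹ * γ * g ∈ K₀ ∧ Y (g⁻¹ * γ * g)) ↔ g⁻¹ * u * g ∈ K₀) :
    {q : G ⧸ K₀ | q ∈ MulAction.fixedBy (G ⧸ K₀) γ ∧ Y (q.out⁻¹ * γ * q.out)} = MulAction.fixedBy (G ⧸ K₀) u := by
  ext q
  simp only [mem_setOf_eq]
  have hq : q = ((q.out : G) : G ⧸ K₀) := q.out_eq'.symm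
  have h1 : q ∈ MulAction.fixedBy (G ⧸ K₀) γ ↔ q.out⁻¹ * γ * q.out ∈ K₀ := by
    conv_lhs => rw [hq]
    exact mem_fixedBy_quotient_mk_iff K₀ γ q.out
  have h2 : q ∈ MulAction.fixedBy (G ⧸ K₀) u ↔ q.out⁻¹ * u * q.out ∈ K₀ := by
    conv_lhs => rw [hq]
    exact mem_fixedBy_quotient_mk_iff K₀ u q.out
  rw [h1, h2]
  exact h q.out

/-! ## §2 Interior level-one fixed cosets of `γ` = fixed cosets of the shift `u`; the count form -/

/-- **INTERIOR FIXED COSETS = FIXED COSETS OF THE SHIFT**: for `0 < |ϖ| < 1`, `γ u ∈ G` with `e u, (e u)⁻¹ ∈ 𝒪[X]` and `X ∈ 𝒪[e u]`, `X = 1 + ϖ⁻¹(e γ − 1)`: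
`{q ∈ Fix_γ(G⧸K) : (q.out⁻¹ γ q.out)_w ≡ 1 (mod ϖ)} = Fix_u(G⧸K)`. [cite: Kottwitz1986, §3] [cite: Laumon1995, Lemma (5.3.2) p. 136] [cite: Rogawski1990, §4.9 Prop. 4.9.1 (a) p. 55] -/
theorem sep_fixedBy_interior_eq_fixedBy_of_mem_adjoin {ϖ : w.1.adicCompletion L} (hϖ0 : ϖ ≠ 0) (hϖ1 : Valued.v ϖ < 1)
    (γ u : (cmDatum L N H).Local v)
    (hu : (((localNonsplitEquiv (IsCMField.complexConj L) H hc w hw u :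
        ↥(unitaryGroupOfForm (galAdicCompletionMap (L := L) (IsCMField.complexConj L) hw) (placeForm H w.1))) : GL (Fin N) (w.1.adicCompletion L)) :
          Matrix (Fin N) (Fin N) (w.1.adicCompletion L)) ∈
      Algebra.adjoin 𝒪[w.1.adicCompletion L] ({1 + ϖ⁻¹ • ((((localNonsplitEquiv (IsCMField.complexConj L) H hc w hw γ :
        ↥(unitaryGroupOfForm (galAdicCompletionMap (L := L) (IsCMField.complexConj L) hw) (placeForm H w.1))) : GL (Fin N) (w.1.adicCompletion L)) :
          Matrix (Fin N) (Fin N) (w.1.adicCompletion L)) - 1)} : Set (Matrix (Fin N) (Fin N) (w.1.adicCompletion L))))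
    (hu' : ((((localNonsplitEquiv (IsCMField.complexConj L) H hc w hw u :
        ↥(unitaryGroupOfForm (galAdicCompletionMap (L := L) (IsCMField.complexConj L) hw) (placeForm H w.1))) : GL (Fin N) (w.1.adicCompletion L))⁻¹ :
          GL (Fin N) (w.1.adicCompletion L)) : Matrix (Fin N) (Fin N) (w.1.adicCompletion L)) ∈
      Algebra.adjoin 𝒪[w.1.adicCompletion L] ({1 + ϖ⁻¹ • ((((localNonsplitEquiv (IsCMField.complexConj L) H hc w hw γ :
        ↥(unitaryGroupOfForm (galAdicCompletionMap (L := L) (IsCMField.complexConj L) hw) (placeForm H w.1))) : GL (Fin N) (w.1.adicCompletion L)) :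
          Matrix (Fin N) (Fin N) (w.1.adicCompletion L)) - 1)} : Set (Matrix (Fin N) (Fin N) (w.1.adicCompletion L))))
    (hX : (1 + ϖ⁻¹ • ((((localNonsplitEquiv (IsCMField.complexConj L) H hc w hw γ :
        ↥(unitaryGroupOfForm (galAdicCompletionMap (L := L) (IsCMField.complexConj L) hw) (placeForm H w.1))) : GL (Fin N) (w.1.adicCompletion L)) :
          Matrix (Fin N) (Fin N) (w.1.adicCompletion L)) - 1)) ∈
      Algebra.adjoin 𝒪[w.1.adicCompletion L] ({(((localNonsplitEquiv (IsCMField.complexConj L) H hc w hw u :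
        ↥(unitaryGroupOfForm (galAdicCompletionMap (L := L) (IsCMField.complexConj L) hw) (placeForm H w.1))) : GL (Fin N) (w.1.adicCompletion L)) :
          Matrix (Fin N) (Fin N) (w.1.adicCompletion L))} : Set (Matrix (Fin N) (Fin N) (w.1.adicCompletion L)))) :
    {q : (cmDatum L N H).Local v ⧸ cmLocalIntegralLevel L N H v |
        q ∈ MulAction.fixedBy ((cmDatum L N H).Local v ⧸ cmLocalIntegralLevel L N H v) γ ∧
        IsIntMatrix (ϖ⁻¹ • ((((localNonsplitEquiv (IsCMField.complexConj L) H hc w hw (q.out⁻¹ * γ * q.out) :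
          ↥(unitaryGroupOfForm (galAdicCompletionMap (L := L) (IsCMField.complexConj L) hw) (placeForm H w.1))) : GL (Fin N) (w.1.adicCompletion L)) :
            Matrix (Fin N) (Fin N) (w.1.adicCompletion L)) - 1))} =
      MulAction.fixedBy ((cmDatum L N H).Local v ⧸ cmLocalIntegralLevel L N H v) u := by
  refine sep_fixedBy_quotient_eq_fixedBy (cmLocalIntegralLevel L N H v) γ u
    (fun x => IsIntMatrix (ϖ⁻¹ • ((((localNonsplitEquiv (IsCMField.complexConj L) H hc w hw x :
      ↥(unitaryGroupOfForm (galAdicCompletionMap (L := L) (IsCMField.complexConj L) hw) (placeForm H w.1))) : GL (Fin N) (w.1.adicCompletion L)) :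
        Matrix (Fin N) (Fin N) (w.1.adicCompletion L)) - 1))) fun g => ?_
  have e1 : ∀ A B : GL (Fin N) (w.1.adicCompletion L), (A⁻¹ * B * A)⁻¹ = A⁻¹ * B⁻¹ * A := fun A B => by group
  rw [mem_cmLocalIntegralLevel_iff_isIntMatrix L N H hc w hw, mem_cmLocalIntegralLevel_iff_isIntMatrix L N H hc w hw,
    coe_localNonsplitEquiv_conj L N H hc w hw g γ, coe_localNonsplitEquiv_conj L N H hc w hw g u]
  generalize ((localNonsplitEquiv (IsCMField.complexConj L) H hc w hw g :
      ↥(unitaryGroupOfForm (galAdicCompletionMap (L := L) (IsCMField.complexConj L) hw) (placeForm H w.1))) : GL (Fin N) (w.1.adicCompletion L)) = A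
  rw [e1, e1]
  refine Iff.trans (and_congr (mapGL_latt_eq_latt_iff _ A).symm
    ((isIntMatrix_inv_smul_iff hϖ0 _).trans (map_sub_one_latt_le_scaleLattice_iff hϖ0 _ A).symm)) ?_
  refine (mapGL_eq_and_level_iff_map_levelShift_le hϖ0 hϖ1 _ A).trans ?_
  refine Iff.trans ?_ (mapGL_latt_eq_latt_iff _ A)
  exact (mapGL_eq_iff_map_toLin'_le _ _ hu hu' hX).symm

/-- **COUNT FORM `sum_fixedBy_interior_eq_sum_fixedBy_cayley_relabel`** (A-69 (iii), A-85 (5)): for EVERY summand `F` on `G ⧸ K`,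
`∑ᶠ_{q ∈ Fix_γ, (q⁻¹γq)_w ≡ 1 (ϖ)} F q = ∑ᶠ_{q ∈ Fix_u} F q` — the interior part of the unfolded orbital integral of `γ` is a sum over the fixed cosets of the Cayley shift `u`
(values relabelled by §3). [cite: Kottwitz1986, §3] [cite: Rogawski1990, §4.9 Prop. 4.9.1 (a) p. 55] -/
theorem sum_fixedBy_interior_eq_sum_fixedBy_cayley_relabel {β : Type*} [AddCommMonoid β] {ϖ : w.1.adicCompletion L} (hϖ0 : ϖ ≠ 0) (hϖ1 : Valued.v ϖ < 1)
    (γ u : (cmDatum L N H).Local v)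
    (hu : (((localNonsplitEquiv (IsCMField.complexConj L) H hc w hw u :
        ↥(unitaryGroupOfForm (galAdicCompletionMap (L := L) (IsCMField.complexConj L) hw) (placeForm H w.1))) : GL (Fin N) (w.1.adicCompletion L)) :
          Matrix (Fin N) (Fin N) (w.1.adicCompletion L)) ∈
      Algebra.adjoin 𝒪[w.1.adicCompletion L] ({1 + ϖ⁻¹ • ((((localNonsplitEquiv (IsCMField.complexConj L) H hc w hw γ :
        ↥(unitaryGroupOfForm (galAdicCompletionMap (L := L) (IsCMField.complexConj L) hw) (placeForm H w.1))) : GL (Fin N) (w.1.adicCompletion L)) :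
          Matrix (Fin N) (Fin N) (w.1.adicCompletion L)) - 1)} : Set (Matrix (Fin N) (Fin N) (w.1.adicCompletion L))))
    (hu' : ((((localNonsplitEquiv (IsCMField.complexConj L) H hc w hw u :
        ↥(unitaryGroupOfForm (galAdicCompletionMap (L := L) (IsCMField.complexConj L) hw) (placeForm H w.1))) : GL (Fin N) (w.1.adicCompletion L))⁻¹ :
          GL (Fin N) (w.1.adicCompletion L)) : Matrix (Fin N) (Fin N) (w.1.adicCompletion L)) ∈
      Algebra.adjoin 𝒪[w.1.adicCompletion L] ({1 + ϖ⁻¹ • ((((localNonsplitEquiv (IsCMField.complexConj L) H hc w hw γ :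
        ↥(unitaryGroupOfForm (galAdicCompletionMap (L := L) (IsCMField.complexConj L) hw) (placeForm H w.1))) : GL (Fin N) (w.1.adicCompletion L)) :
          Matrix (Fin N) (Fin N) (w.1.adicCompletion L)) - 1)} : Set (Matrix (Fin N) (Fin N) (w.1.adicCompletion L))))
    (hX : (1 + ϖ⁻¹ • ((((localNonsplitEquiv (IsCMField.complexConj L) H hc w hw γ :
        ↥(unitaryGroupOfForm (galAdicCompletionMap (L := L) (IsCMField.complexConj L) hw) (placeForm H w.1))) : GL (Fin N) (w.1.adicCompletion L)) :
          Matrix (Fin N) (Fin N) (w.1.adicCompletion L)) - 1)) ∈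
      Algebra.adjoin 𝒪[w.1.adicCompletion L] ({(((localNonsplitEquiv (IsCMField.complexConj L) H hc w hw u :
        ↥(unitaryGroupOfForm (galAdicCompletionMap (L := L) (IsCMField.complexConj L) hw) (placeForm H w.1))) : GL (Fin N) (w.1.adicCompletion L)) :
          Matrix (Fin N) (Fin N) (w.1.adicCompletion L))} : Set (Matrix (Fin N) (Fin N) (w.1.adicCompletion L))))
    (F : (cmDatum L N H).Local v ⧸ cmLocalIntegralLevel L N H v → β) :
    ∑ᶠ q ∈ {q : (cmDatum L N H).Local v ⧸ cmLocalIntegralLevel L N H v |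
        q ∈ MulAction.fixedBy ((cmDatum L N H).Local v ⧸ cmLocalIntegralLevel L N H v) γ ∧
        IsIntMatrix (ϖ⁻¹ • ((((localNonsplitEquiv (IsCMField.complexConj L) H hc w hw (q.out⁻¹ * γ * q.out) :
          ↥(unitaryGroupOfForm (galAdicCompletionMap (L := L) (IsCMField.complexConj L) hw) (placeForm H w.1))) : GL (Fin N) (w.1.adicCompletion L)) :
            Matrix (Fin N) (Fin N) (w.1.adicCompletion L)) - 1))}, F q =
      ∑ᶠ q ∈ MulAction.fixedBy ((cmDatum L N H).Local v ⧸ cmLocalIntegralLevel L N H v) u, F q := by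
  rw [sep_fixedBy_interior_eq_fixedBy_of_mem_adjoin L N H hc w hw hϖ0 hϖ1 γ u hu hu' hX]

/-! ## §3 Relabelling of values: a level-2 class datum of `γ` on the interior fixed cosets is a level-1 class datum of `u` -/

/-- **`e(g⁻¹γg) = r(e(g⁻¹ug))`** for every `g ∈ G`, when `q(e u) = 1 + ϖ⁻¹(e γ − 1)` (`q ∈ 𝒪_w[T]`, `r := 1 + ϖ·(q − 1)`; ★ `units_conj_eq_aeval_relabel` read through `e`).
[cite: Kottwitz1986, §3] [cite: Rogawski1990, §4.9 Prop. 4.9.1 (a) p. 55] -/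
theorem coe_localNonsplitEquiv_conj_eq_aeval_relabel {ϖ : w.1.adicCompletion L} (hϖ0 : ϖ ≠ 0) (hϖi : ϖ ∈ 𝒪[w.1.adicCompletion L])
    (γ u : (cmDatum L N H).Local v) (q : (𝒪[w.1.adicCompletion L])[X])
    (hq : aeval (((localNonsplitEquiv (IsCMField.complexConj L) H hc w hw u :
        ↥(unitaryGroupOfForm (galAdicCompletionMap (L := L) (IsCMField.complexConj L) hw) (placeForm H w.1))) : GL (Fin N) (w.1.adicCompletion L)) :
          Matrix (Fin N) (Fin N) (w.1.adicCompletion L)) q =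
      1 + ϖ⁻¹ • ((((localNonsplitEquiv (IsCMField.complexConj L) H hc w hw γ :
        ↥(unitaryGroupOfForm (galAdicCompletionMap (L := L) (IsCMField.complexConj L) hw) (placeForm H w.1))) : GL (Fin N) (w.1.adicCompletion L)) :
          Matrix (Fin N) (Fin N) (w.1.adicCompletion L)) - 1))
    (g : (cmDatum L N H).Local v) :
    (((localNonsplitEquiv (IsCMField.complexConj L) H hc w hw (g⁻¹ * γ * g) :
        ↥(unitaryGroupOfForm (galAdicCompletionMap (L := L) (IsCMField.complexConj L) hw) (placeForm H w.1))) : GL (Fin N) (w.1.adicCompletion L)) :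
          Matrix (Fin N) (Fin N) (w.1.adicCompletion L)) =
      aeval (((localNonsplitEquiv (IsCMField.complexConj L) H hc w hw (g⁻¹ * u * g) :
        ↥(unitaryGroupOfForm (galAdicCompletionMap (L := L) (IsCMField.complexConj L) hw) (placeForm H w.1))) : GL (Fin N) (w.1.adicCompletion L)) :
          Matrix (Fin N) (Fin N) (w.1.adicCompletion L)) (1 + C (⟨ϖ, hϖi⟩ : 𝒪[w.1.adicCompletion L]) * (q - 1)) := by
  rw [coe_localNonsplitEquiv_conj L N H hc w hw g γ, coe_localNonsplitEquiv_conj L N H hc w hw g u]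
  exact units_conj_eq_aeval_relabel (c := (⟨ϖ, hϖi⟩ : 𝒪[w.1.adicCompletion L])) hϖ0 _ _ _ q hq

/-- `e (x * k⁻¹) = e x * (e k)⁻¹` in `GL_N(L_w)`. [cite: PlatonovRapinchuk1994, §5.1] -/
theorem coe_localNonsplitEquiv_mul_inv (x k : (cmDatum L N H).Local v) :
    ((localNonsplitEquiv (IsCMField.complexConj L) H hc w hw (x * k⁻¹) :
        ↥(unitaryGroupOfForm (galAdicCompletionMap (L := L) (IsCMField.complexConj L) hw) (placeForm H w.1))) : GL (Fin N) (w.1.adicCompletion L)) =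
      ((localNonsplitEquiv (IsCMField.complexConj L) H hc w hw x :
          ↥(unitaryGroupOfForm (galAdicCompletionMap (L := L) (IsCMField.complexConj L) hw) (placeForm H w.1))) : GL (Fin N) (w.1.adicCompletion L)) *
        ((localNonsplitEquiv (IsCMField.complexConj L) H hc w hw k :
          ↥(unitaryGroupOfForm (galAdicCompletionMap (L := L) (IsCMField.complexConj L) hw) (placeForm H w.1))) : GL (Fin N) (w.1.adicCompletion L))⁻¹ := by
  have h1 : localNonsplitEquiv (IsCMField.complexConj L) H hc w hw (x * k⁻¹) =
      localNonsplitEquiv (IsCMField.complexConj L) H hc w hw x * localNonsplitEquiv (IsCMField.complexConj L) H hc w hw k⁻¹ :=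
    map_mul (localNonsplitEquiv (IsCMField.complexConj L) H hc w hw) _ _
  have h2 : localNonsplitEquiv (IsCMField.complexConj L) H hc w hw k⁻¹ = (localNonsplitEquiv (IsCMField.complexConj L) H hc w hw k)⁻¹ :=
    map_inv (localNonsplitEquiv (IsCMField.complexConj L) H hc w hw) _
  rw [h1, h2, Subgroup.coe_mul, Subgroup.coe_inv]

set_option maxHeartbeats 400000 in
/-- **THE VALUE OF A LEVEL-2 PIECE AT AN INTERIOR FIXED COSET IS A LEVEL-1 CLASS DATUM OF THE SHIFT** (A-69 (β) at `j = 2`, A-85 (5)): let `ψ : G → β` be left-invariant under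
«`U_w ≡ 1 (mod ϖ²)`» (`hψ2`), `q(e u) = 1 + ϖ⁻¹(e γ − 1)`, `r := 1 + ϖ·(q − 1)`.  If `g⁻¹ug ∈ K` (a fixed coset of `u`), `k ∈ K` with `(g⁻¹ug)_w ≡ k_w (mod ϖ)` (the level-1 class
of `u` at the coset) and `k₂ ∈ K` with `r(k_w) ≡ (k₂)_w (mod ϖ²)` (a representative of the relabelled class), then `ψ(g⁻¹γg) = ψ(k₂)`.  Proof: `e(g⁻¹γg) = r(e(g⁻¹ug)) ≡ r(e k)`
`(mod ϖ²)` (THE LEVEL GAIN ★ `isIntMatrix_inv_pow_succ_smul_aeval_relabel_sub`) `≡ e k₂`, so `g⁻¹γg = U·k₂` with `U_w ≡ 1 (mod ϖ²)`. [cite: Kottwitz1986, §3]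
[cite: Rogawski1990, §4.9 Prop. 4.9.1 (a) p. 55] -/
theorem apply_conj_eq_of_levelTwo_of_relabel {β : Type*} (ψ : (cmDatum L N H).Local v → β) {ϖ : w.1.adicCompletion L} (hϖ0 : ϖ ≠ 0)
    (hϖi : ϖ ∈ 𝒪[w.1.adicCompletion L])
    (hψ2 : ∀ U : (cmDatum L N H).Local v, IsIntMatrix ((ϖ ^ 2)⁻¹ • ((((localNonsplitEquiv (IsCMField.complexConj L) H hc w hw U :
        ↥(unitaryGroupOfForm (galAdicCompletionMap (L := L) (IsCMField.complexConj L) hw) (placeForm H w.1))) : GL (Fin N) (w.1.adicCompletion L)) :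
          Matrix (Fin N) (Fin N) (w.1.adicCompletion L)) - 1)) → ∀ x, ψ (U * x) = ψ x)
    (γ u : (cmDatum L N H).Local v) (q : (𝒪[w.1.adicCompletion L])[X])
    (hq : aeval (((localNonsplitEquiv (IsCMField.complexConj L) H hc w hw u :
        ↥(unitaryGroupOfForm (galAdicCompletionMap (L := L) (IsCMField.complexConj L) hw) (placeForm H w.1))) : GL (Fin N) (w.1.adicCompletion L)) :
          Matrix (Fin N) (Fin N) (w.1.adicCompletion L)) q =
      1 + ϖ⁻¹ • ((((localNonsplitEquiv (IsCMField.complexConj L) H hc w hw γ :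
        ↥(unitaryGroupOfForm (galAdicCompletionMap (L := L) (IsCMField.complexConj L) hw) (placeForm H w.1))) : GL (Fin N) (w.1.adicCompletion L)) :
          Matrix (Fin N) (Fin N) (w.1.adicCompletion L)) - 1))
    (g : (cmDatum L N H).Local v) (hg : g⁻¹ * u * g ∈ cmLocalIntegralLevel L N H v)
    (k : (cmDatum L N H).Local v) (hk : k ∈ cmLocalIntegralLevel L N H v)
    (hgk : IsIntMatrix (ϖ⁻¹ • ((((localNonsplitEquiv (IsCMField.complexConj L) H hc w hw (g⁻¹ * u * g) :
        ↥(unitaryGroupOfForm (galAdicCompletionMap (L := L) (IsCMField.complexConj L) hw) (placeForm H w.1))) : GL (Fin N) (w.1.adicCompletion L)) :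
          Matrix (Fin N) (Fin N) (w.1.adicCompletion L)) -
      (((localNonsplitEquiv (IsCMField.complexConj L) H hc w hw k :
        ↥(unitaryGroupOfForm (galAdicCompletionMap (L := L) (IsCMField.complexConj L) hw) (placeForm H w.1))) : GL (Fin N) (w.1.adicCompletion L)) :
          Matrix (Fin N) (Fin N) (w.1.adicCompletion L)))))
    (k₂ : (cmDatum L N H).Local v) (hk₂ : k₂ ∈ cmLocalIntegralLevel L N H v)
    (hkk₂ : IsIntMatrix ((ϖ ^ 2)⁻¹ • (aeval (((localNonsplitEquiv (IsCMField.complexConj L) H hc w hw k :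
        ↥(unitaryGroupOfForm (galAdicCompletionMap (L := L) (IsCMField.complexConj L) hw) (placeForm H w.1))) : GL (Fin N) (w.1.adicCompletion L)) :
          Matrix (Fin N) (Fin N) (w.1.adicCompletion L)) (1 + C (⟨ϖ, hϖi⟩ : 𝒪[w.1.adicCompletion L]) * (q - 1)) -
      (((localNonsplitEquiv (IsCMField.complexConj L) H hc w hw k₂ :
        ↥(unitaryGroupOfForm (galAdicCompletionMap (L := L) (IsCMField.complexConj L) hw) (placeForm H w.1))) : GL (Fin N) (w.1.adicCompletion L)) :
          Matrix (Fin N) (Fin N) (w.1.adicCompletion L))))) :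
    ψ (g⁻¹ * γ * g) = ψ k₂ := by
  -- integrality of the matrices of `g⁻¹ug`, `k`, `k₂⁻¹`
  have hB := ((mem_cmLocalIntegralLevel_iff_isIntMatrix L N H hc w hw _).1 hg).1
  have hek := ((mem_cmLocalIntegralLevel_iff_isIntMatrix L N H hc w hw _).1 hk).1
  have hek₂i := ((mem_cmLocalIntegralLevel_iff_isIntMatrix L N H hc w hw _).1 hk₂).2
  -- the level gain: `r(e(g⁻¹ug)) ≡ r(e k) (mod ϖ²)`
  have hgk' : IsIntMatrix (((((⟨ϖ, hϖi⟩ : 𝒪[w.1.adicCompletion L]) : 𝒪[w.1.adicCompletion L]) : w.1.adicCompletion L) ^ 1)⁻¹ •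
      ((((localNonsplitEquiv (IsCMField.complexConj L) H hc w hw (g⁻¹ * u * g) :
        ↥(unitaryGroupOfForm (galAdicCompletionMap (L := L) (IsCMField.complexConj L) hw) (placeForm H w.1))) : GL (Fin N) (w.1.adicCompletion L)) :
          Matrix (Fin N) (Fin N) (w.1.adicCompletion L)) -
      (((localNonsplitEquiv (IsCMField.complexConj L) H hc w hw k :
        ↥(unitaryGroupOfForm (galAdicCompletionMap (L := L) (IsCMField.complexConj L) hw) (placeForm H w.1))) : GL (Fin N) (w.1.adicCompletion L)) :
          Matrix (Fin N) (Fin N) (w.1.adicCompletion L)))) := by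
    rw [pow_one]; exact hgk
  have h1 := isIntMatrix_inv_pow_succ_smul_aeval_relabel_sub hB hek (c := (⟨ϖ, hϖi⟩ : 𝒪[w.1.adicCompletion L])) hϖ0 1 hgk' q
  rw [show (1 : ℕ) + 1 = 2 from rfl] at h1
  -- hence `e(g⁻¹γg) ≡ e k₂ (mod ϖ²)`
  have h2 : IsIntMatrix ((ϖ ^ 2)⁻¹ • ((((localNonsplitEquiv (IsCMField.complexConj L) H hc w hw (g⁻¹ * γ * g) :
        ↥(unitaryGroupOfForm (galAdicCompletionMap (L := L) (IsCMField.complexConj L) hw) (placeForm H w.1))) : GL (Fin N) (w.1.adicCompletion L)) :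
          Matrix (Fin N) (Fin N) (w.1.adicCompletion L)) -
      (((localNonsplitEquiv (IsCMField.complexConj L) H hc w hw k₂ :
        ↥(unitaryGroupOfForm (galAdicCompletionMap (L := L) (IsCMField.complexConj L) hw) (placeForm H w.1))) : GL (Fin N) (w.1.adicCompletion L)) :
          Matrix (Fin N) (Fin N) (w.1.adicCompletion L)))) := by
    rw [coe_localNonsplitEquiv_conj_eq_aeval_relabel L N H hc w hw hϖ0 hϖi γ u q hq g, ← sub_add_sub_cancel _ (aeval (((localNonsplitEquiv (IsCMField.complexConj L) H hc w hw k :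
        ↥(unitaryGroupOfForm (galAdicCompletionMap (L := L) (IsCMField.complexConj L) hw) (placeForm H w.1))) : GL (Fin N) (w.1.adicCompletion L)) :
          Matrix (Fin N) (Fin N) (w.1.adicCompletion L)) (1 + C (⟨ϖ, hϖi⟩ : 𝒪[w.1.adicCompletion L]) * (q - 1))) _, smul_add]
    exact isIntMatrix_add h1 hkk₂
  -- `g⁻¹γg = U · k₂` with `U_w − 1 = (e(g⁻¹γg) − e k₂)·(e k₂)⁻¹ ≡ 0 (mod ϖ²)`
  have hU : IsIntMatrix ((ϖ ^ 2)⁻¹ • ((((localNonsplitEquiv (IsCMField.complexConj L) H hc w hw (g⁻¹ * γ * g * k₂⁻¹) :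
        ↥(unitaryGroupOfForm (galAdicCompletionMap (L := L) (IsCMField.complexConj L) hw) (placeForm H w.1))) : GL (Fin N) (w.1.adicCompletion L)) :
          Matrix (Fin N) (Fin N) (w.1.adicCompletion L)) - 1)) := by
    rw [coe_localNonsplitEquiv_mul_inv L N H hc w hw, Units.val_mul]
    have e : ((((localNonsplitEquiv (IsCMField.complexConj L) H hc w hw (g⁻¹ * γ * g) :
          ↥(unitaryGroupOfForm (galAdicCompletionMap (L := L) (IsCMField.complexConj L) hw) (placeForm H w.1))) : GL (Fin N) (w.1.adicCompletion L)) :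
            Matrix (Fin N) (Fin N) (w.1.adicCompletion L)) *
          ((((localNonsplitEquiv (IsCMField.complexConj L) H hc w hw k₂ :
            ↥(unitaryGroupOfForm (galAdicCompletionMap (L := L) (IsCMField.complexConj L) hw) (placeForm H w.1))) : GL (Fin N) (w.1.adicCompletion L))⁻¹ :
              GL (Fin N) (w.1.adicCompletion L)) : Matrix (Fin N) (Fin N) (w.1.adicCompletion L)) - 1) =
        ((((localNonsplitEquiv (IsCMField.complexConj L) H hc w hw (g⁻¹ * γ * g) :
          ↥(unitaryGroupOfForm (galAdicCompletionMap (L := L) (IsCMField.complexConj L) hw) (placeForm H w.1))) : GL (Fin N) (w.1.adicCompletion L)) :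
            Matrix (Fin N) (Fin N) (w.1.adicCompletion L)) -
          (((localNonsplitEquiv (IsCMField.complexConj L) H hc w hw k₂ :
            ↥(unitaryGroupOfForm (galAdicCompletionMap (L := L) (IsCMField.complexConj L) hw) (placeForm H w.1))) : GL (Fin N) (w.1.adicCompletion L)) :
              Matrix (Fin N) (Fin N) (w.1.adicCompletion L))) *
          ((((localNonsplitEquiv (IsCMField.complexConj L) H hc w hw k₂ :
            ↥(unitaryGroupOfForm (galAdicCompletionMap (L := L) (IsCMField.complexConj L) hw) (placeForm H w.1))) : GL (Fin N) (w.1.adicCompletion L))⁻¹ :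
              GL (Fin N) (w.1.adicCompletion L)) : Matrix (Fin N) (Fin N) (w.1.adicCompletion L)) := by
      rw [Matrix.sub_mul, Units.mul_inv]
    rw [e, ← Matrix.smul_mul]
    exact isIntMatrix_mul h2 hek₂i
  have hfin := hψ2 _ hU k₂
  rwa [inv_mul_cancel_right] at hfin

end Place

end Literature.NumberTheory.Automorphic

end
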